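import Mathlib
import Summits.KontsevichZagierPeriods.Zeta5Search.FourthOrderTaylor
import Summits.KontsevichZagierPeriods.Zeta5Search.FourthOrderReflect
import HarnessLib

/-!
# ζ(5) search — the coefficients of the class polynomial `H_x` and the `τ₃`-digit `h₃ ≡ −p³ ĝ_x κ_i(x)` (tools for THEOREM L5)

Cell `pub-zeta5` (HONEST FRAMING: systematic search; no irrationality claim unless certified), typer seat generation 13.
REPORT-gen2-g14 §2, Lemma P (the `τ₃`-coefficient): for a live class `x` of layer `i = E_x + M ≤ 3` with class polynomial
`H_x = (−p)^i ĝ_x · Q_x(X + a) · P_tot` (`classH`; `P_tot = Z_x(X+a)·P_x` monic of degree `i` with integral coefficients — `natDegree_Ptot`,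
from `E(T) = −M`):
* `padicNorm_classH_coeff_le` — `‖[X^m] H_x‖ ≤ p^{−m}` for every `m`;
* `padicNorm_classH_coeff_three` — **`‖[X³] H_x + p³ ĝ_x κ_{3−i}(x)‖ ≤ p⁻⁴`**, `κ₀ = 1, κ₁ = φ_x, κ₂ = c_x, κ₃ = c₃,x` (`kappaQ`);
* the Taylor coefficients `h_n` of `H_x` at the frame centre `L/2`: `‖h₁‖ ≤ p⁻¹`, `‖h₃‖ ≤ p⁻³`, `‖h₅‖ ≤ p⁻⁵`, **`‖h₃ + p³ĝ_xκ‖ ≤ p⁻⁴`**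
  (`padicNorm_classTaylor_*`).
`p`-adic norms of rational numbers; nothing here bears on irrationality.
-/

noncomputable section

open Finset

namespace Summit.KontsevichZagierPeriods.Zeta5Search.SecondOrder

open Summit.KontsevichZagierPeriods.Zeta5Search.CasoratianValuation (InPolytope)
open Summit.KontsevichZagierPeriods.Zeta5Search.ClusterValuation
open Summit.KontsevichZagierPeriods.Zeta5Search.PadicSeries
open Summit.KontsevichZagierPeriods.Zeta5Search.CellA (padicNorm_p)
open Summit.KontsevichZagierPeriods.Zeta5Search.LevelClass (typeExp level_mem)
open Summit.KontsevichZagierPeriods.Zeta5Search.BigPrime (padicNorm_mul_le_one)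
open Summit.KontsevichZagierPeriods.Zeta5Search.SecondResidueLaw (phi3Hat cubicHat)

variable {p : ℕ} [hp : Fact p.Prime]

/-! ## §1 The coefficients of `Q_x` and of `Q_x(X + a)` -/

/-- `κ_j(x)`: `κ₀ = 1`, `κ₁ = φ_x`, `κ₂ = c_x`, `κ₃ = c₃,x` (so that `[X^j]Q_x = (−p)^j κ_j`). -/
def kappaQ (b : ℕ → ℤ) (p x j : ℕ) : ℚ :=
  if j = 0 then 1 else if j = 1 then phiHat b p x else if j = 2 then curvHat b p x else cubicHat b p x

/-- `‖κ_j‖ ≤ 1` (`p ≥ 5`). -/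
theorem padicNorm_kappaQ_le_one (b : ℕ → ℤ) (hp5 : 5 ≤ p) (x j : ℕ) : padicNorm p (kappaQ b p x j) ≤ 1 := by
  have hp2 : p ≠ 2 := by omega
  unfold kappaQ
  split_ifs
  · rw [padicNorm.one]
  · exact padicNorm_phiHat_le_one b hp2 x
  · exact padicNorm_curvHat_le_one b hp2 x
  · exact padicNorm_cubicHat_le_one b hp5 x

omit hp in
/-- **`[X^j] Q_x = (−p)^j κ_j`** for `j ≤ 3`, and `0` beyond. -/
theorem fourthQ_coeff (b : ℕ → ℤ) (p x j : ℕ) :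
    (fourthQ b p x).coeff j = if j ≤ 3 then (-(p : ℚ)) ^ j * kappaQ b p x j else 0 := by
  unfold fourthQ kappaQ
  simp only [Polynomial.coeff_sub, Polynomial.coeff_add, Polynomial.coeff_one, Polynomial.coeff_C_mul,
    Polynomial.coeff_X_pow, Polynomial.coeff_X, mul_ite, mul_one, mul_zero]
  rcases Nat.lt_or_ge j 4 with hj | hj
  · interval_cases j <;> norm_num [neg_pow]
  · simp only [show j ≠ 0 by omega, show (1 : ℕ) ≠ j by omega, show j ≠ 2 by omega, show j ≠ 3 by omega,
      show ¬ j ≤ 3 by omega, if_false]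
    norm_num

/-- `‖[X^j] Q_x‖ ≤ p^{−j}`. -/
theorem padicNorm_fourthQ_coeff_le (b : ℕ → ℤ) (hp5 : 5 ≤ p) (x j : ℕ) :
    padicNorm p ((fourthQ b p x).coeff j) ≤ (p : ℚ) ^ (-(j : ℤ)) := by
  rw [fourthQ_coeff]
  split_ifs
  · rw [padicNorm.mul, ← zpow_natCast, LevelClass.padicNorm_neg_p_zpow]
    exact mul_le_of_le_one_right (zpow_p_nonneg _) (padicNorm_kappaQ_le_one b hp5 x j)
  · rw [padicNorm.zero]; exact zpow_p_nonneg _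

/-- **`‖[X^j] Q_x(X + a)‖ ≤ p^{−j}`** (`a : ℕ`). -/
theorem padicNorm_fourthQ_taylor_coeff_le (b : ℕ → ℤ) (hp5 : 5 ≤ p) (x a j : ℕ) :
    padicNorm p ((Polynomial.taylor (a : ℚ) (fourthQ b p x)).coeff j) ≤ (p : ℚ) ^ (-(j : ℤ)) := by
  refine padicNorm_taylor_coeff_le _ (by simpa using padicNorm.of_nat (p := p) a) j (zpow_p_nonneg _) fun m hm => ?_
  exact (padicNorm_fourthQ_coeff_le b hp5 x m).trans (zpow_le_zpow_right₀ one_le_p (by omega))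

/-- **`‖[X^j] Q_x(X + a) − [X^j] Q_x‖ ≤ p^{−(j+1)}`**: the shift changes each coefficient only at the next order. -/
theorem padicNorm_fourthQ_taylor_coeff_sub_le (b : ℕ → ℤ) (hp5 : 5 ≤ p) (x a j : ℕ) :
    padicNorm p ((Polynomial.taylor (a : ℚ) (fourthQ b p x)).coeff j - (fourthQ b p x).coeff j) ≤ (p : ℚ) ^ (-((j : ℤ) + 1)) := by
  refine padicNorm_taylor_coeff_sub_le _ (by simpa using padicNorm.of_nat (p := p) a) j (zpow_p_nonneg _) fun m hm => ?_
  exact (padicNorm_fourthQ_coeff_le b hp5 x m).trans (zpow_le_zpow_right₀ one_le_p (by omega))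

/-! ## §2 The total shape factor `P_tot = Z_x(X + a) · P_x`: monic of degree `E_x + M`, integral -/

section Ptot

variable (b : ℕ → ℤ) (hb : InPolytope b) (hp5 : 5 ≤ p) (hpn : (p : ℤ) ≤ b 0) {x : ℕ} (hx : x < p)
  {M L a : ℕ} {e : ℕ → ℤ} (hTM : typeExp L e = -(M : ℤ))
  (hdom : Dominates L e (topLevel b p x) (fun k => netExp b (x + k * p)) a)
include hb hp5 hpn hx hTM hdom

/-- The total shape factor. -/
def Ptot (b : ℕ → ℤ) (p x L a : ℕ) (e : ℕ → ℤ) : Polynomial ℚ :=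
  (centreZ b p x (topLevel b p x)).comp (Polynomial.X + Polynomial.C (a : ℚ)) *
    shapePoly L a (topLevel b p x) e (fun k => netExp b (x + k * p))

omit hp hb hp5 hpn hx hTM hdom in
/-- `H_x = (−p)^{E+M} ĝ_x · Q_x(X + a) · P_tot`. -/
theorem classH_eq_taylor : classH b p x M L a e = Polynomial.C ((-(p : ℚ)) ^ (classExp b p x + M) * gHat b p x) *
    (Polynomial.taylor (a : ℚ) (fourthQ b p x) * Ptot b p x L a e) := by
  rw [classH, Ptot, Polynomial.taylor_apply, Polynomial.mul_comp, mul_assoc]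

omit hp hb hp5 hpn hx hTM hdom in
/-- `P_tot` is monic. -/
theorem Ptot_monic : (Ptot b p x L a e).Monic := by
  unfold Ptot centreZ
  refine Polynomial.Monic.mul ?_ (shapePoly_monic (L := L) (a := a) (L' := topLevel b p x) (e := e) (f := fun k => netExp b (x + k * p)))
  split_ifs
  · rw [Polynomial.sub_comp, Polynomial.X_comp, Polynomial.C_comp, add_sub_assoc, ← map_sub]
    exact Polynomial.monic_X_add_C _
  · rw [Polynomial.one_comp]; exact Polynomial.monic_one

omit hb hp5 in
/-- **`deg P_tot = E_x + M`** (uses `E(T) = −M`). -/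
theorem natDegree_Ptot : ((Ptot b p x L a e).natDegree : ℤ) = classExp b p x + M := by
  have hxn : x ≤ (b 0).toNat := le_b0_of_lt b hpn hx
  obtain ⟨hL, hL'⟩ := level_bounds' (p := p) b hxn
  have hdeg := shapePoly_natDegree_eq hdom.le hdom.dom (e := e) (f := fun k => netExp b (x + k * p))
  have hE := classExp_levelZ b hx hL hL'
  have hZmon : ((centreZ b p x (topLevel b p x)).comp (Polynomial.X + Polynomial.C (a : ℚ))).Monic ∧
      (((centreZ b p x (topLevel b p x)).comp (Polynomial.X + Polynomial.C (a : ℚ))).natDegree : ℤ) =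
        (if ¬ (2 : ℤ) ∣ b 0 ∧ CentreIn b p x then 1 else 0) := by
    unfold centreZ
    split_ifs
    · rw [Polynomial.sub_comp, Polynomial.X_comp, Polynomial.C_comp, add_sub_assoc, ← map_sub]
      exact ⟨Polynomial.monic_X_add_C _, by rw [Polynomial.natDegree_X_add_C]; rfl⟩
    · rw [Polynomial.one_comp]; exact ⟨Polynomial.monic_one, by simp⟩
  rw [Ptot, Polynomial.Monic.natDegree_mul hZmon.1 (shapePoly_monic (f := fun k => netExp b (x + k * p))), Nat.cast_add,
    hZmon.2, hdeg, hTM, hE]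
  ring

omit hb hp5 hpn hx hTM hdom in
/-- `P_tot` has integral coefficients. -/
theorem padicNorm_Ptot_coeff_le_one (hp2 : p ≠ 2) (k : ℕ) : padicNorm p ((Ptot b p x L a e).coeff k) ≤ 1 := by
  have h1 : CoeffBound p 0 0 (((centreZ b p x (topLevel b p x)).comp (Polynomial.X + Polynomial.C (a : ℚ)) : Polynomial ℚ) :
      PowerSeries ℚ) := by
    unfold centreZ
    split_ifs
    · rw [Polynomial.sub_comp, Polynomial.X_comp, Polynomial.C_comp, add_sub_assoc, ← map_sub, Polynomial.coe_add,
        Polynomial.coe_X, Polynomial.coe_C]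
      refine coeffBound_X_add_C le_rfl ?_
      rw [neg_zero, zpow_zero]
      exact (padicNorm.sub (p := p)).trans (max_le (by simpa using padicNorm.of_nat (p := p) a)
        (by rw [padicNorm.div, padicNorm_two hp2, div_one]; simpa using padicNorm.of_nat (p := p) (topLevel b p x)))
    · rw [Polynomial.one_comp, Polynomial.coe_one]; exact coeffBound_one
  have h2 : CoeffBound p 0 0 ((shapePoly L a (topLevel b p x) e (fun k => netExp b (x + k * p)) : Polynomial ℚ) : PowerSeries ℚ) :=
    fun k => by
      rw [Polynomial.coeff_coe]
      simpa using (padicNorm_shapePoly_coeff_le_one k :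
        padicNorm p ((shapePoly L a (topLevel b p x) e (fun k => netExp b (x + k * p))).coeff k) ≤ 1)
  have h := (h1.mul h2) k
  rw [← Polynomial.coe_mul, Polynomial.coeff_coe] at h
  unfold Ptot
  simpa using h

end Ptot

/-! ## §3 The coefficients of `H_x` -/

/-- `‖L/2‖ ≤ 1` for odd `p`. -/
theorem padicNorm_half_L_le_one (hp2 : p ≠ 2) (L : ℕ) : padicNorm p ((L : ℚ) / 2) ≤ 1 := by
  rw [padicNorm.div, padicNorm_two hp2, div_one]; simpa using padicNorm.of_nat (p := p) L

section Coeff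

variable (b : ℕ → ℤ) (hp5 : 5 ≤ p) (hpn : (p : ℤ) ≤ b 0) {x : ℕ} (hx : x < p)
  {M L a : ℕ} {e : ℕ → ℤ} (hTM : typeExp L e = -(M : ℤ))
  (hdom : Dominates L e (topLevel b p x) (fun k => netExp b (x + k * p)) a) {i : ℕ} (hi : classExp b p x + M = i)
include hp5 hpn hx hTM hdom hi

/-- Coefficients of the scaled shape factor `(−p)^i ĝ · P_tot`: norm `≤ p^{−i}`, and `≤ p^{−k}` at degree `k`, vanishing beyond `i`. -/
theorem scaledPtot_coeff (k : ℕ) :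
    padicNorm p ((-(p : ℚ)) ^ (classExp b p x + M) * gHat b p x * (Ptot b p x L a e).coeff k) ≤ (p : ℚ) ^ (-(i : ℤ)) ∧
    padicNorm p ((-(p : ℚ)) ^ (classExp b p x + M) * gHat b p x * (Ptot b p x L a e).coeff k) ≤ (p : ℚ) ^ (-(k : ℤ)) ∧
    (i < k → (Ptot b p x L a e).coeff k = 0) := by
  have hp2 : p ≠ 2 := by omega
  have hdegP : (Ptot b p x L a e).natDegree = i := by
    have := natDegree_Ptot b hpn hx hTM hdom; omega
  have hzero : i < k → (Ptot b p x L a e).coeff k = 0 := fun hk =>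
    Polynomial.coeff_eq_zero_of_natDegree_lt (by rw [hdegP]; exact hk)
  have hs : padicNorm p ((-(p : ℚ)) ^ (classExp b p x + M) * gHat b p x) ≤ (p : ℚ) ^ (-(i : ℤ)) := by
    rw [padicNorm.mul, hi, LevelClass.padicNorm_neg_p_zpow]
    exact mul_le_of_le_one_right (zpow_p_nonneg _) (padicNorm_gHat_le_one' b hp5 x)
  have h1 : padicNorm p ((-(p : ℚ)) ^ (classExp b p x + M) * gHat b p x * (Ptot b p x L a e).coeff k) ≤ (p : ℚ) ^ (-(i : ℤ)) :=
    padicNorm_mul_le_left hs (padicNorm_Ptot_coeff_le_one b hp2 k)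
  refine ⟨h1, ?_, hzero⟩
  rcases Nat.lt_or_ge i k with hk | hk
  · rw [hzero hk, mul_zero, padicNorm.zero]; exact zpow_p_nonneg _
  · exact h1.trans (zpow_le_zpow_right₀ one_le_p (by omega))

/-- **`‖[X^m] H_x‖ ≤ p^{−m}`** for every `m`. -/
theorem padicNorm_classH_coeff_le (m : ℕ) : padicNorm p ((classH b p x M L a e).coeff m) ≤ (p : ℚ) ^ (-(m : ℤ)) := by
  rw [classH_eq_taylor, Polynomial.coeff_C_mul, Polynomial.coeff_mul, mul_sum]
  refine padicNorm.sum_le' (fun jk hjk => ?_) (zpow_p_nonneg _)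
  have hsum : jk.1 + jk.2 = m := mem_antidiagonal.1 hjk
  rw [show (-(p : ℚ)) ^ (classExp b p x + M) * gHat b p x * ((Polynomial.taylor (a : ℚ) (fourthQ b p x)).coeff jk.1 *
      (Ptot b p x L a e).coeff jk.2) = (Polynomial.taylor (a : ℚ) (fourthQ b p x)).coeff jk.1 *
        ((-(p : ℚ)) ^ (classExp b p x + M) * gHat b p x * (Ptot b p x L a e).coeff jk.2) by ring]
  have h := fo_mul (padicNorm_fourthQ_taylor_coeff_le b hp5 x a jk.1) (scaledPtot_coeff b hp5 hpn hx hTM hdom hi jk.2).2.1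
  rw [← hsum, Nat.cast_add]; exact h

/-- **THE `τ₃`-DIGIT OF THE CLASS**: `‖[X³] H_x + p³ ĝ_x κ_{3−i}(x)‖ ≤ p⁻⁴` for a class of layer `i ≤ 3`. -/
theorem padicNorm_classH_coeff_three (hi3 : i ≤ 3) :
    padicNorm p ((classH b p x M L a e).coeff 3 + (p : ℚ) ^ 3 * gHat b p x * kappaQ b p x (3 - i)) ≤ (p : ℚ) ^ (-(4 : ℤ)) := by
  have hp2 : p ≠ 2 := by omega
  have hp0 : (p : ℚ) ≠ 0 := Nat.cast_ne_zero.2 hp.out.ne_zero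
  have hdegP : (Ptot b p x L a e).natDegree = i := by have := natDegree_Ptot b hpn hx hTM hdom; omega
  have hPi : (Ptot b p x L a e).coeff i = 1 := by
    rw [← hdegP]; exact (Ptot_monic b (p := p) (x := x) (L := L) (a := a) (e := e)).coeff_natDegree
  set s : ℚ := (-(p : ℚ)) ^ (classExp b p x + M) * gHat b p x with hsdef
  set Qa := Polynomial.taylor (a : ℚ) (fourthQ b p x) with hQa
  set P := Ptot b p x L a e with hP
  -- the coefficient as a sum over the antidiagonal, with the special term `(3 − i, i)` split off
  have hmem : (3 - i, i) ∈ antidiagonal 3 := mem_antidiagonal.2 (by omega)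
  rw [classH_eq_taylor, Polynomial.coeff_C_mul, Polynomial.coeff_mul, ← Finset.add_sum_erase _ _ hmem]
  simp only
  rw [hPi, mul_one]
  -- the special term: `s · Qa_{3−i} = s q_{3−i} + s (Qa_{3−i} − q_{3−i}) = −p³ĝκ + small`
  have hspecial : s * Qa.coeff (3 - i) + (p : ℚ) ^ 3 * gHat b p x * kappaQ b p x (3 - i) =
      s * (Qa.coeff (3 - i) - (fourthQ b p x).coeff (3 - i)) := by
    rw [fourthQ_coeff, if_pos (by omega), hsdef, hi, zpow_natCast]
    have e3 : (-(p : ℚ)) ^ i * (-(p : ℚ)) ^ (3 - i) = -(p : ℚ) ^ 3 := by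
      rw [← pow_add, show i + (3 - i) = 3 by omega, neg_pow, show ((-1 : ℚ)) ^ 3 = -1 by norm_num]; ring
    have e4 : (-(p : ℚ)) ^ i * gHat b p x * ((-(p : ℚ)) ^ (3 - i) * kappaQ b p x (3 - i)) =
        ((-(p : ℚ)) ^ i * (-(p : ℚ)) ^ (3 - i)) * gHat b p x * kappaQ b p x (3 - i) := by ring
    rw [mul_sub, e4, e3]; ring
  have e : s * Qa.coeff (3 - i) + ∑ jk ∈ (antidiagonal 3).erase (3 - i, i), s * (Qa.coeff jk.1 * P.coeff jk.2)
        + (p : ℚ) ^ 3 * gHat b p x * kappaQ b p x (3 - i) =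
      s * (Qa.coeff (3 - i) - (fourthQ b p x).coeff (3 - i))
        + ∑ jk ∈ (antidiagonal 3).erase (3 - i, i), s * (Qa.coeff jk.1 * P.coeff jk.2) := by
    rw [← hspecial]; ring
  rw [mul_add, mul_sum, e]
  have hs : padicNorm p s ≤ (p : ℚ) ^ (-(i : ℤ)) := by
    rw [hsdef, padicNorm.mul, hi, LevelClass.padicNorm_neg_p_zpow]
    exact mul_le_of_le_one_right (zpow_p_nonneg _) (padicNorm_gHat_le_one' b hp5 x)
  refine fo_add ?_ (padicNorm.sum_le' (fun jk hjk => ?_) (zpow_p_nonneg _))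
  · have h := fo_mul hs (padicNorm_fourthQ_taylor_coeff_sub_le b hp5 x a (3 - i))
    refine h.trans (le_of_eq ?_); congr 1; omega
  · obtain ⟨hne, hjk'⟩ := Finset.mem_erase.1 hjk
    have hsum : jk.1 + jk.2 = 3 := mem_antidiagonal.1 hjk'
    rcases Nat.lt_or_ge i jk.2 with hk | hk
    · rw [(scaledPtot_coeff b hp5 hpn hx hTM hdom hi jk.2).2.2 hk, mul_zero, mul_zero, padicNorm.zero]; exact zpow_p_nonneg _
    · have hk' : jk.2 < i := by
        rcases Nat.lt_or_ge jk.2 i with h | h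
        · exact h
        · exfalso; apply hne; ext <;> simp <;> omega
      rw [show s * (Qa.coeff jk.1 * P.coeff jk.2) = Qa.coeff jk.1 * (s * P.coeff jk.2) by ring]
      have h := fo_mul (padicNorm_fourthQ_taylor_coeff_le b hp5 x a jk.1) (scaledPtot_coeff b hp5 hpn hx hTM hdom hi jk.2).1
      exact h.trans (zpow_le_zpow_right₀ one_le_p (by omega))

/-! ### The Taylor coefficients at the frame centre -/

/-- **`‖h₁‖ ≤ p⁻¹`**, `h_n` the Taylor coefficients of `H_x` at `L/2`. -/
theorem padicNorm_classTaylor_one :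
    padicNorm p ((Polynomial.taylor ((L : ℚ) / 2) (classH b p x M L a e)).coeff 1) ≤ (p : ℚ) ^ (-(1 : ℤ)) :=
  padicNorm_taylor_coeff_le _ (padicNorm_half_L_le_one (by omega) L) 1 (zpow_p_nonneg _) fun m hm =>
    (padicNorm_classH_coeff_le b hp5 hpn hx hTM hdom hi m).trans (zpow_le_zpow_right₀ one_le_p (by omega))

/-- **`‖h₃‖ ≤ p⁻³`**. -/
theorem padicNorm_classTaylor_three_le :
    padicNorm p ((Polynomial.taylor ((L : ℚ) / 2) (classH b p x M L a e)).coeff 3) ≤ (p : ℚ) ^ (-(3 : ℤ)) :=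
  padicNorm_taylor_coeff_le _ (padicNorm_half_L_le_one (by omega) L) 3 (zpow_p_nonneg _) fun m hm =>
    (padicNorm_classH_coeff_le b hp5 hpn hx hTM hdom hi m).trans (zpow_le_zpow_right₀ one_le_p (by omega))

/-- **`‖h₅‖ ≤ p⁻⁵`**. -/
theorem padicNorm_classTaylor_five :
    padicNorm p ((Polynomial.taylor ((L : ℚ) / 2) (classH b p x M L a e)).coeff 5) ≤ (p : ℚ) ^ (-(5 : ℤ)) :=
  padicNorm_taylor_coeff_le _ (padicNorm_half_L_le_one (by omega) L) 5 (zpow_p_nonneg _) fun m hm =>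
    (padicNorm_classH_coeff_le b hp5 hpn hx hTM hdom hi m).trans (zpow_le_zpow_right₀ one_le_p (by omega))

/-- **THE `τ₃`-DIGIT AT THE CENTRE: `‖h₃ + p³ ĝ_x κ_{3−i}(x)‖ ≤ p⁻⁴`.** -/
theorem padicNorm_classTaylor_three (hi3 : i ≤ 3) :
    padicNorm p ((Polynomial.taylor ((L : ℚ) / 2) (classH b p x M L a e)).coeff 3 + (p : ℚ) ^ 3 * gHat b p x * kappaQ b p x (3 - i))
      ≤ (p : ℚ) ^ (-(4 : ℤ)) := by
  have h1 : padicNorm p ((Polynomial.taylor ((L : ℚ) / 2) (classH b p x M L a e)).coeff 3 - (classH b p x M L a e).coeff 3)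
      ≤ (p : ℚ) ^ (-(4 : ℤ)) :=
    padicNorm_taylor_coeff_sub_le _ (padicNorm_half_L_le_one (by omega) L) 3 (zpow_p_nonneg _) fun m hm =>
      (padicNorm_classH_coeff_le b hp5 hpn hx hTM hdom hi m).trans (zpow_le_zpow_right₀ one_le_p (by omega))
  have h2 := padicNorm_classH_coeff_three b hp5 hpn hx hTM hdom hi hi3
  have e : (Polynomial.taylor ((L : ℚ) / 2) (classH b p x M L a e)).coeff 3 + (p : ℚ) ^ 3 * gHat b p x * kappaQ b p x (3 - i) =
      ((Polynomial.taylor ((L : ℚ) / 2) (classH b p x M L a e)).coeff 3 - (classH b p x M L a e).coeff 3)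
        + ((classH b p x M L a e).coeff 3 + (p : ℚ) ^ 3 * gHat b p x * kappaQ b p x (3 - i)) := by ring
  rw [e]; exact fo_add h1 h2

omit hp5 in
/-- `deg H_x ≤ 6`. -/
theorem natDegree_classH_le (hi3 : i ≤ 3) : (classH b p x M L a e).natDegree ≤ 6 := by
  have hdegP : (Ptot b p x L a e).natDegree = i := by have := natDegree_Ptot b hpn hx hTM hdom; omega
  rw [classH_eq_taylor]
  refine (Polynomial.natDegree_C_mul_le _ _).trans ((Polynomial.natDegree_mul_le).trans ?_)
  rw [Polynomial.natDegree_taylor, hdegP]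
  have := natDegree_fourthQ_le b p x
  omega

end Coeff

end Summit.KontsevichZagierPeriods.Zeta5Search.SecondOrder

end
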